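import Summits.QuantumAdvantage.AdviceFreeQNC0.R1JuntaSize39
import HarnessLib

/-!
# Cell qa-qnc0, `p = 3` — (R1) up to the CAP NUMBER of the read family, and (R1) for CELL-CONFINED outside reads of unbounded
# multiplicity (prover qn-prover-3 g26; sequel of `R1OneFibre39` / `R1DisjointReads39` / `R1JuntaSize39`)

The fibre method brute-forces every coin outside a chosen set `A` of twisted letters; what it needs of `A` is only that each reading
set meets `A` in few letters.  Two book-keeping consequences of the tree theorems of qn-prover-3 g25, which re-state the open regime of
(R1) `TwistedJunta36.TwistedJuntaBoundX3S` as a question of extremal combinatorics about the read family ALONE: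

* **`AffBells22.norm_twistedWinSum_le_of_capSet`** — the `d`-RELAXED TRANSVERSAL ("cap set") form: if `A ⊆ supp β` meets every reading
  set `T k` in at most `d` letters, then `‖Σ_x e₃(β·x)[OddZeros x ∧ Rel x (g x)]‖ ≤ 3·ρ_d^{#A}·2^N`, `ρ_d = (7 + e^{−3/(8·4^{max d 1})})/8`
  (`R1JuntaSize39.norm_twistedWinSum_le_juntaSize` with `W := Aᶜ`).  So (R1) holds for every read family whose `d`-cap number on the
  twisted outside letters (largest `A` met `≤ d` times by every `T k ∖ W`) is `≳ #(supp β ∖ W)/(log₂N)^C` for some fixed `d`; `d = 1` is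
  the transversal form of `R1OneFibre39` (rate `39/40`).  The residual regime of (R1) is thus: read families of `(log₂N)^C`-sets whose
  `d`-cap numbers are all small — design-like families hosting symmetric polynomials — where the liveness of the bells must be used.
* `AffBells22.exists_transversal_of_eqOrDisjoint` — sets `R k ⊆ D` of size `≤ s`, pairwise EQUAL OR DISJOINT ⇒ a transversal `A ⊆ D` with
  `#D ≤ s·#A` (deduplicate, then `exists_transversal_of_pairwiseDisjoint`);
* **`AffBells22.norm_twistedWinSum_le_of_eqOrDisjointReads`**, **`GradedSeeds38.twistedJuntaBoundX3S_of_eqOrDisjointReads`** — (R1)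
  VERBATIM + "the outside reads `T k ∖ W` are pairwise equal or disjoint": UNBOUNDED multiplicity (any number of bells may read the same
  outside set, with arbitrary tables), every `C`, `A = 1`, `n₀ = 3`;
* **`GradedSeeds38.twistedJuntaBoundX3S_of_cellReads`** — (R1) VERBATIM + "the outside reads are confined to the cells of a partition of
  the letters whose outside parts have `≤ (log₂N)^C` letters" (arbitrary overlaps and multiplicities INSIDE cells): enlarge each outside
  read to its cell;
* **`GradedSeeds38.seedJuntaHardXS_of_eqOrDisjointReads`**, **`seedJuntaHardXS_of_cellReads`** — the structured branch (graded-spread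
  seeds ⊕ such juntas, one `θ < 1`, every `C`) UNCONDITIONAL for both classes (`seedJuntaHard_of_restrictedR1`).

WHAT THIS IS NOT: nothing for read families with small cap numbers (cross-cell overlaps of unbounded multiplicity); crux
`stmt-QuantumAdvantage-22907` untouched.
-/

noncomputable section

namespace Summit.QuantumAdvantage.AdviceFreeQNC0

open Finset Literature.Computability.QuantumComplexity Literature.Computability.QuantumComplexity.RingHLF
open Literature.Computability.MetaComplexity
open scoped Classical

namespace AffBells22

variable {N : ℕ}

/-! ## The cap-set (`d`-relaxed transversal) form of (R1) -/

/-- **THE CAP-SET FORM OF (R1).**  If bell `k` reads only `T k` and `A ⊆ supp β` meets every `T k` in at most `d` letters, then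
`‖Σ_x e₃(β·x)·[OddZeros x ∧ Rel x (g x)]‖ ≤ 3·ρ_d^{#A}·2^N` with `ρ_d = (7 + e^{−3/(8·4^{max d 1})})/8 < 1` (`N ≥ 3`): the bounded-size
theorem `norm_twistedWinSum_le_juntaSize` with tolerance set `W := Aᶜ` (fibre method + Viola–Wigderson on the `A`-coins). -/
theorem norm_twistedWinSum_le_of_capSet (hN : 3 ≤ N) (T : Fin N → Finset (Fin N)) (g : Fin N → (Fin N → Bool) → Bool)
    (hg : ∀ k, ReadsOnly (T k) (g k)) (β : Fin N → ZMod 3) (d : ℕ) (A : Finset (Fin N))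
    (hA : ∀ k, (T k ∩ A).card ≤ d) (hAβ : ∀ i ∈ A, β i ≠ 0) :
    ‖∑ x : Fin N → Bool, (ZMod.stdAddChar (∑ i : Fin N, if x i then β i else 0) : ℂ) *
        (if (OddZeros x ∧ RingHLF.Rel x (fun k => g k x)) then (1 : ℂ) else 0)‖
      ≤ 3 * ((7 + Real.exp (-(3 / (8 * 4 ^ (max d 1))))) / 8) ^ A.card * (2 : ℝ) ^ N := by
  classical
  have hT : ∀ k, (T k \ (univ \ A)).card ≤ d := by
    intro k
    have e : T k \ (univ \ A) = T k ∩ A := by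
      ext i; simp [mem_sdiff, mem_inter]
    rw [e]; exact hA k
  have h := norm_twistedWinSum_le_juntaSize hN (univ \ A) T g hg hT β
  have hfilt : (univ.filter fun j : Fin N => j ∉ (univ \ A) ∧ β j ≠ 0) = A := by
    ext j
    simp only [mem_filter, mem_univ, true_and, mem_sdiff, not_not]
    exact ⟨fun h => h.1, fun hj => ⟨hj, hAβ j hj⟩⟩
  rw [hfilt] at h
  exact h

/-! ## Transversals of equal-or-disjoint families; (R1) for such outside reads -/

/-- **Transversals of equal-or-disjoint families.**  If the sets `R k ⊆ D` have at most `s ≥ 1` elements each and are pairwise EQUAL OR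
DISJOINT, then some `A ⊆ D` meets every `R k` at most once and has `#D ≤ s·#A` (deduplicate the family and apply
`exists_transversal_of_pairwiseDisjoint`). -/
theorem exists_transversal_of_eqOrDisjoint {κ : Type*} (D : Finset (Fin N)) (R : κ → Finset (Fin N)) (s : ℕ)
    (hs : 1 ≤ s) (hRD : ∀ k, R k ⊆ D) (hRs : ∀ k, (R k).card ≤ s)
    (hed : ∀ k k', R k = R k' ∨ Disjoint (R k) (R k')) :
    ∃ A ⊆ D, (∀ k, (R k ∩ A).card ≤ 1) ∧ D.card ≤ s * A.card := by
  classical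
  -- the distinct members of the family, as a finite family indexed by a subtype of `D.powerset`
  set F : Finset (Finset (Fin N)) := D.powerset.filter (fun S => ∃ k, R k = S) with hF
  have hmemF : ∀ k, R k ∈ F := fun k => mem_filter.mpr ⟨mem_powerset.mpr (hRD k), k, rfl⟩
  obtain ⟨A, hAD, hA1, hDA⟩ := exists_transversal_of_pairwiseDisjoint (κ := {S // S ∈ F}) D (fun S => S.val) s hs
    (fun S => mem_powerset.mp (mem_filter.mp S.2).1)
    (fun S => by obtain ⟨k, hk⟩ := (mem_filter.mp S.2).2; rw [← hk]; exact hRs k)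
    (fun S S' hne => by
      obtain ⟨k, hk⟩ := (mem_filter.mp S.2).2
      obtain ⟨k', hk'⟩ := (mem_filter.mp S'.2).2
      rcases hed k k' with h | h
      · exact absurd (Subtype.ext (hk.symm.trans (h.trans hk'))) hne
      · rw [← hk, ← hk']; exact h)
  exact ⟨A, hAD, fun k => hA1 ⟨R k, hmemF k⟩, hDA⟩

/-- **(R1) for EQUAL-OR-DISJOINT outside reads.**  If bell `k` reads only `T k`, the outside parts `T k ∖ W` have at most `s ≥ 1` letters
and are pairwise equal or disjoint (`W` ARBITRARY; any number of bells may share an outside read set), then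
`‖Σ_x e₃(β·x)[OddZeros x ∧ Rel x (g x)]‖ ≤ 2·(39/40)^{#(supp β ∖ W)/s}·2^N` (`N ≥ 3`). -/
theorem norm_twistedWinSum_le_of_eqOrDisjointReads (hN : 3 ≤ N) {s : ℕ} (hs : 1 ≤ s) (W : Finset (Fin N))
    (T : Fin N → Finset (Fin N)) (g : Fin N → (Fin N → Bool) → Bool) (hg : ∀ k, ReadsOnly (T k) (g k))
    (hTs : ∀ k, (T k \ W).card ≤ s) (hed : ∀ k k', T k \ W = T k' \ W ∨ Disjoint (T k \ W) (T k' \ W))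
    (β : Fin N → ZMod 3) :
    ‖∑ x : Fin N → Bool, (ZMod.stdAddChar (∑ i : Fin N, if x i then β i else 0) : ℂ) *
        (if (OddZeros x ∧ RingHLF.Rel x (fun k => g k x)) then (1 : ℂ) else 0)‖
      ≤ 2 * (39 / 40 : ℝ) ^ ((univ.filter fun j : Fin N => j ∉ W ∧ β j ≠ 0).card / s) * (2 : ℝ) ^ N := by
  classical
  set D := univ.filter (fun j : Fin N => j ∉ W ∧ β j ≠ 0) with hDdef
  set R : Fin N → Finset (Fin N) := fun k => (T k \ W) ∩ D with hRdef
  have hRD : ∀ k, R k ⊆ D := fun k => inter_subset_right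
  have hRs : ∀ k, (R k).card ≤ s := fun k => (card_le_card inter_subset_left).trans (hTs k)
  have hRed : ∀ k k', R k = R k' ∨ Disjoint (R k) (R k') := by
    intro k k'
    rcases hed k k' with h | h
    · left; simp only [hRdef]; rw [h]
    · exact Or.inr (h.mono inter_subset_left inter_subset_left)
  obtain ⟨A, hAD, hA1, hDA⟩ := exists_transversal_of_eqOrDisjoint D R s hs hRD hRs hRed
  have hA : ∀ k, (T k ∩ A).card ≤ 1 := by
    intro k
    have hsub : T k ∩ A ⊆ R k ∩ A := by
      intro j hj
      rw [mem_inter] at hj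
      have hjD := hAD hj.2
      exact mem_inter.mpr ⟨mem_inter.mpr ⟨mem_sdiff.mpr ⟨hj.1, (mem_filter.mp hjD).2.1⟩, hjD⟩, hj.2⟩
    exact (card_le_card hsub).trans (hA1 k)
  have hAβ : ∀ j ∈ A, β j ≠ 0 := fun j hj => (mem_filter.mp (hAD hj)).2.2
  refine (norm_twistedWinSum_le_of_transversal hN T g hg β A hA hAβ).trans ?_
  have hdiv : D.card / s ≤ A.card := Nat.div_le_of_le_mul hDA
  have hpow : (39 / 40 : ℝ) ^ A.card ≤ (39 / 40 : ℝ) ^ (D.card / s) :=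
    pow_le_pow_of_le_one (by norm_num) (by norm_num) hdiv
  have h2 : (0 : ℝ) ≤ (2 : ℝ) ^ N := by positivity
  nlinarith [hpow, h2]

/-! ## Cell-confined reads: enlarging every outside read to its cell -/

/-- The cell hull of a reading set: `T k` together with the outside part of the cell of its outside letters. -/
theorem cellHull_sdiff (W : Finset (Fin N)) (cell : Fin N → Fin N) (Tk : Finset (Fin N)) :
    (Tk ∪ univ.filter (fun i' : Fin N => i' ∉ W ∧ ∃ i ∈ Tk \ W, cell i' = cell i)) \ W
      = univ.filter (fun i' : Fin N => i' ∉ W ∧ ∃ i ∈ Tk \ W, cell i' = cell i) := by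
  ext j
  simp only [mem_sdiff, mem_union, mem_filter, mem_univ, true_and]
  constructor
  · rintro ⟨h | h, hjW⟩
    · exact ⟨hjW, j, ⟨h, hjW⟩, rfl⟩
    · exact h
  · intro h
    exact ⟨Or.inr h, h.1⟩

/-- Cell hulls are pairwise equal or disjoint. -/
theorem cellHull_eqOrDisjoint (W : Finset (Fin N)) (cell : Fin N → Fin N) (T : Fin N → Finset (Fin N))
    (hconf : ∀ k, ∀ i ∈ T k \ W, ∀ i' ∈ T k \ W, cell i = cell i') (k k' : Fin N) :
    (T k ∪ univ.filter (fun i' : Fin N => i' ∉ W ∧ ∃ i ∈ T k \ W, cell i' = cell i)) \ W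
        = (T k' ∪ univ.filter (fun i' : Fin N => i' ∉ W ∧ ∃ i ∈ T k' \ W, cell i' = cell i)) \ W ∨
      Disjoint ((T k ∪ univ.filter (fun i' : Fin N => i' ∉ W ∧ ∃ i ∈ T k \ W, cell i' = cell i)) \ W)
        ((T k' ∪ univ.filter (fun i' : Fin N => i' ∉ W ∧ ∃ i ∈ T k' \ W, cell i' = cell i)) \ W) := by
  rw [cellHull_sdiff W cell (T k), cellHull_sdiff W cell (T k')]
  by_cases hmeet : ∃ i ∈ T k \ W, ∃ i' ∈ T k' \ W, cell i = cell i'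
  · left
    obtain ⟨i₀, hi₀, i₀', hi₀', hc⟩ := hmeet
    ext j
    simp only [mem_filter, mem_univ, true_and]
    constructor
    · rintro ⟨hjW, i, hi, hji⟩
      exact ⟨hjW, i₀', hi₀', by rw [hji, hconf k i hi i₀ hi₀, hc]⟩
    · rintro ⟨hjW, i', hi', hji'⟩
      exact ⟨hjW, i₀, hi₀, by rw [hji', hconf k' i' hi' i₀' hi₀', hc]⟩
  · right
    rw [Finset.disjoint_left]
    intro j hj hj'
    obtain ⟨_, i, hi, hji⟩ := (mem_filter.mp hj).2
    obtain ⟨_, i', hi', hji'⟩ := (mem_filter.mp hj').2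
    exact hmeet ⟨i, hi, i', hi', by rw [← hji, hji']⟩

/-- The outside part of a cell hull has at most as many letters as the outside part of a cell. -/
theorem card_cellHull_sdiff_le (W : Finset (Fin N)) (cell : Fin N → Fin N) (Tk : Finset (Fin N)) {s : ℕ}
    (hcell : ∀ j, (univ.filter fun i : Fin N => i ∉ W ∧ cell i = j).card ≤ s)
    (hconf : ∀ i ∈ Tk \ W, ∀ i' ∈ Tk \ W, cell i = cell i') :
    ((Tk ∪ univ.filter (fun i' : Fin N => i' ∉ W ∧ ∃ i ∈ Tk \ W, cell i' = cell i)) \ W).card ≤ s := by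
  rw [cellHull_sdiff W cell Tk]
  rcases (Tk \ W).eq_empty_or_nonempty with h0 | ⟨i₀, hi₀⟩
  · have : (univ.filter (fun i' : Fin N => i' ∉ W ∧ ∃ i ∈ Tk \ W, cell i' = cell i)) = ∅ := by
      refine filter_eq_empty_iff.mpr fun j _ h => ?_
      obtain ⟨i, hi, _⟩ := h.2
      rw [h0] at hi; exact absurd hi (by simp)
    rw [this]; simp
  · refine (card_le_card fun j hj => ?_).trans (hcell (cell i₀))
    obtain ⟨hjW, i, hi, hji⟩ := (mem_filter.mp hj).2
    exact mem_filter.mpr ⟨mem_univ _, hjW, by rw [hji, hconf i hi i₀ hi₀]⟩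

end AffBells22

namespace GradedSeeds38

open AffBells22 TwistedJunta36

/-- **(R1) `TwistedJunta36.TwistedJuntaBoundX3S (39/40)` for EQUAL-OR-DISJOINT outside reads** — the statement of (R1) verbatim with the
single extra hypothesis that the sets `T k ∖ W` are pairwise equal or disjoint (UNBOUNDED multiplicity; `A = 1`, `n₀ = 3`; `3·#W ≤ N`
unused). -/
theorem twistedJuntaBoundX3S_of_eqOrDisjointReads (C : ℕ) :
    ∃ A n₀ : ℕ, ∀ N ≥ n₀,
      ∀ (W : Finset (Fin N)) (T : Fin N → Finset (Fin N)) (g : Fin N → (Fin N → Bool) → Bool),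
        3 * W.card ≤ N → (∀ k, (T k \ W).card ≤ (Nat.log 2 N) ^ C) →
        (∀ k k', T k \ W = T k' \ W ∨ Disjoint (T k \ W) (T k' \ W)) →
        (∀ k (x x' : Fin N → Bool), (∀ i ∈ T k, x i = x' i) → g k x = g k x') →
          ∀ β : Fin N → ZMod 3,
            ‖∑ x : Fin N → Bool, (ZMod.stdAddChar (∑ i : Fin N, if x i then β i else 0) : ℂ) *
                (if (OddZeros x ∧ RingHLF.Rel x (fun k => g k x)) then (1 : ℂ) else 0)‖
              ≤ (N : ℝ) ^ A * (39 / 40 : ℝ) ^ ((univ.filter fun i : Fin N => i ∉ W ∧ β i ≠ 0).card / (Nat.log 2 N) ^ C)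
                  * (2 : ℝ) ^ N := by
  classical
  refine ⟨1, 3, fun N hN W T g _hW hT hed hg β => ?_⟩
  have hlog : 1 ≤ Nat.log 2 N := Nat.le_log_of_pow_le (by norm_num) (by omega)
  have hs : 1 ≤ (Nat.log 2 N) ^ C := Nat.one_le_pow _ _ hlog
  have hTr : ∀ k, ReadsOnly (T k) (g k) := fun k x x' h => hg k x x' h
  have h := norm_twistedWinSum_le_of_eqOrDisjointReads hN hs W T g hTr hT hed β
  rw [pow_one]
  refine h.trans ?_
  have hN2 : (2 : ℝ) ≤ (N : ℝ) := by exact_mod_cast (show 2 ≤ N by omega)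
  have hpos : (0 : ℝ) ≤ (39 / 40 : ℝ) ^ ((univ.filter fun i : Fin N => i ∉ W ∧ β i ≠ 0).card / (Nat.log 2 N) ^ C)
      * (2 : ℝ) ^ N := by positivity
  nlinarith [hpos, hN2]

/-- **(R1) `TwistedJuntaBoundX3S (39/40)` for CELL-CONFINED outside reads** — (R1) verbatim plus: a cell labelling `cell` of the letters
whose cells have `≤ (log₂N)^C` letters outside `W`, every outside read `T k ∖ W` lying in ONE cell (arbitrary overlaps and
multiplicities inside the cells).  Proof: enlarge `T k` by the outside part of its cell; the hulls are equal or disjoint. -/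
theorem twistedJuntaBoundX3S_of_cellReads (C : ℕ) :
    ∃ A n₀ : ℕ, ∀ N ≥ n₀,
      ∀ (W : Finset (Fin N)) (T : Fin N → Finset (Fin N)) (g : Fin N → (Fin N → Bool) → Bool) (cell : Fin N → Fin N),
        3 * W.card ≤ N → (∀ k, (T k \ W).card ≤ (Nat.log 2 N) ^ C) →
        (∀ j, (univ.filter fun i : Fin N => i ∉ W ∧ cell i = j).card ≤ (Nat.log 2 N) ^ C) →
        (∀ k, ∀ i ∈ T k \ W, ∀ i' ∈ T k \ W, cell i = cell i') →
        (∀ k (x x' : Fin N → Bool), (∀ i ∈ T k, x i = x' i) → g k x = g k x') →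
          ∀ β : Fin N → ZMod 3,
            ‖∑ x : Fin N → Bool, (ZMod.stdAddChar (∑ i : Fin N, if x i then β i else 0) : ℂ) *
                (if (OddZeros x ∧ RingHLF.Rel x (fun k => g k x)) then (1 : ℂ) else 0)‖
              ≤ (N : ℝ) ^ A * (39 / 40 : ℝ) ^ ((univ.filter fun i : Fin N => i ∉ W ∧ β i ≠ 0).card / (Nat.log 2 N) ^ C)
                  * (2 : ℝ) ^ N := by
  classical
  obtain ⟨A, n₀, hA⟩ := twistedJuntaBoundX3S_of_eqOrDisjointReads C
  refine ⟨A, n₀, fun N hN W T g cell hW _hT hcell hconf hg β => ?_⟩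
  set T' : Fin N → Finset (Fin N) := fun k =>
    T k ∪ univ.filter (fun i' : Fin N => i' ∉ W ∧ ∃ i ∈ T k \ W, cell i' = cell i) with hT'
  have hT's : ∀ k, (T' k \ W).card ≤ (Nat.log 2 N) ^ C := fun k =>
    card_cellHull_sdiff_le W cell (T k) hcell (hconf k)
  have hed : ∀ k k', T' k \ W = T' k' \ W ∨ Disjoint (T' k \ W) (T' k' \ W) := fun k k' =>
    cellHull_eqOrDisjoint W cell T hconf k k'
  have hg' : ∀ k (x x' : Fin N → Bool), (∀ i ∈ T' k, x i = x' i) → g k x = g k x' :=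
    fun k x x' h => hg k x x' (fun i hi => h i (mem_union_left _ hi))
  exact hA N hN W T' g hW hT's hed hg' β

open scoped Classical in
/-- **THE STRUCTURED BRANCH FOR EQUAL-OR-DISJOINT SCATTERED JUNTAS — UNCONDITIONAL.**  Graded-spread seeds (schedule
`(log₂N)^C·(50(j+1) + D·log₂N)` outside `W`, `3·#W ≤ N`) ⊕ juntas reading `T k` with `#(T k ∖ W) ≤ (log₂N)^C` and the outside reads
pairwise equal or disjoint (any multiplicity): `≤ θ·2^{N−1}` winning odd inputs, one `θ < 1`, every `C`, every number `R` of seeds. -/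
theorem seedJuntaHardXS_of_eqOrDisjointReads :
    ∃ θ : ℝ, θ < 1 ∧ ∀ C : ℕ, ∃ D n₀ : ℕ, ∀ N ≥ n₀,
      ∀ (W : Finset (Fin N)) (R : ℕ) (c : Fin R → Fin N → ZMod 3) (T : Fin N → Finset (Fin N))
        (H : Fin N → (Fin R → ZMod 3) → (Fin N → Bool) → Bool),
        3 * W.card ≤ N → GradedSpreadOff W c (fun j => (Nat.log 2 N) ^ C * (50 * (j.val + 1) + D * Nat.log 2 N)) →
        (∀ k, (T k \ W).card ≤ (Nat.log 2 N) ^ C) →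
        (∀ k k', T k \ W = T k' \ W ∨ Disjoint (T k \ W) (T k' \ W)) →
        (∀ k v (x x' : Fin N → Bool), (∀ i ∈ T k, x i = x' i) → H k v x = H k v x') →
          ((univ.filter fun x : Fin N → Bool =>
              OddZeros x ∧ RingHLF.Rel x (fun k => H k (LinForms.resVec c x) x)).card : ℝ)
            ≤ θ * (2 : ℝ) ^ (N - 1) :=
  seedJuntaHard_of_restrictedR1
    (fun N W T => ∀ k k' : Fin N, T k \ W = T k' \ W ∨ Disjoint (T k \ W) (T k' \ W))
    (ρ := 39 / 40) (α := 50) (by norm_num) three_mul_rho_pow_fifty_lt_one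
    (fun C => twistedJuntaBoundX3S_of_eqOrDisjointReads C)

open scoped Classical in
/-- **THE STRUCTURED BRANCH FOR CELL-CONFINED SCATTERED JUNTAS — UNCONDITIONAL.**  As above for outside reads confined to the cells of
a labelling `cell` whose cells have `≤ (log₂N)^C` letters outside `W` (arbitrary overlaps and multiplicities inside cells); one `θ < 1`
for every `C` and every number of seeds. -/
theorem seedJuntaHardXS_of_cellReads :
    ∃ θ : ℝ, θ < 1 ∧ ∀ C : ℕ, ∃ D n₀ : ℕ, ∀ N ≥ n₀,
      ∀ (W : Finset (Fin N)) (R : ℕ) (c : Fin R → Fin N → ZMod 3) (T : Fin N → Finset (Fin N))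
        (H : Fin N → (Fin R → ZMod 3) → (Fin N → Bool) → Bool) (cell : Fin N → Fin N),
        3 * W.card ≤ N → GradedSpreadOff W c (fun j => (Nat.log 2 N) ^ C * (50 * (j.val + 1) + D * Nat.log 2 N)) →
        (∀ k, (T k \ W).card ≤ (Nat.log 2 N) ^ C) →
        (∀ j, (univ.filter fun i : Fin N => i ∉ W ∧ cell i = j).card ≤ (Nat.log 2 N) ^ C) →
        (∀ k, ∀ i ∈ T k \ W, ∀ i' ∈ T k \ W, cell i = cell i') →
        (∀ k v (x x' : Fin N → Bool), (∀ i ∈ T k, x i = x' i) → H k v x = H k v x') →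
          ((univ.filter fun x : Fin N → Bool =>
              OddZeros x ∧ RingHLF.Rel x (fun k => H k (LinForms.resVec c x) x)).card : ℝ)
            ≤ θ * (2 : ℝ) ^ (N - 1) := by
  classical
  obtain ⟨θ, hθ, hall⟩ := seedJuntaHardXS_of_eqOrDisjointReads
  refine ⟨θ, hθ, fun C => ?_⟩
  obtain ⟨D, n₀, hD⟩ := hall C
  refine ⟨D, n₀, fun N hN W R c T H cell hW hspread _hT hcell hconf hH => ?_⟩
  set T' : Fin N → Finset (Fin N) := fun k =>
    T k ∪ univ.filter (fun i' : Fin N => i' ∉ W ∧ ∃ i ∈ T k \ W, cell i' = cell i) with hT'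
  have hT's : ∀ k, (T' k \ W).card ≤ (Nat.log 2 N) ^ C := fun k =>
    card_cellHull_sdiff_le W cell (T k) hcell (hconf k)
  have hed : ∀ k k', T' k \ W = T' k' \ W ∨ Disjoint (T' k \ W) (T' k' \ W) := fun k k' =>
    cellHull_eqOrDisjoint W cell T hconf k k'
  have hH' : ∀ k v (x x' : Fin N → Bool), (∀ i ∈ T' k, x i = x' i) → H k v x = H k v x' :=
    fun k v x x' h => hH k v x x' (fun i hi => h i (mem_union_left _ hi))
  exact hD N hN W R c T' H hW hspread hT's hed hH'

end GradedSeeds38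

end Summit.QuantumAdvantage.AdviceFreeQNC0

end
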